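import Mathlib
import Summits.KontsevichZagierPeriods.Zeta5Search.CollinearityOrbits
import HarnessLib

/-!
# ζ(5) search — gen-2 g9's COLLINEARITY CRITERION (regimes H0 and T) is a THEOREM
# (`CollinearityCriterionT` and `CollinearityCriterion`, REPORT-gen2-g9 §6.2 / §9.1; part 4 of 4)

Cell `pub-zeta5` (HONEST FRAMING: systematic search; no irrationality claim unless certified), typer seat generation 10.
Discharges BY NAME `CollinearityCriterionT` and `CollinearityCriterion` (`Zeta5Search/UniversalDigitCells.lean` §5): if `−N` (`N ≥ 3`) is the
multipole minimum of the class exponents, every deeper class is a tame single-pole class (regime T; in regime H0 there is none), and the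
orbit digit-vectors `(P_K(x), P_V(x))` of the depth-`N` classes lie on one affine line `aK + cV + e ≡ 0 (mod p)` (`(a,c) ≢ 0`) — through the
origin, or else with the two moment congruences `Σ ḡ_x ≡ Σ π_j(x)ḡ_x ≡ 0` (hypotheses in regime T; consequences of the MOMENT LEMMA
`gHatMoments_holds` in regime H0 when `(N−1)p + 2 ≤ 2d + 3`) — then `v_p(Cas_j(b)) ≥ casLB + 1`.

PROOF (gen-2's).  With the normalised sums `K̃ = (−p)^{N−3}𝒦_p`, `Ṽ = (−p)^N V` (`CollinearityDigits`: `p`-integral, images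
`Σ_{x deep} ḡ_x σ̄_K(x)`, `Σ ḡ_x v̄_x` in `𝔽_p`; for `b + e_j` the selected classes are the unhit deep classes of `b` and the images are
the `π_j`-weighted sums, `CollinearityOrbits.sum_unhit_shift_eq`; tame classes contribute nothing since `ν ≥ 0` persists under the shift),
`Cas_j = −(𝒦⁺V − 𝒦V⁺)` (`p ≤ d`, `omegaRes_eq_zero`) equals `−(−p)^{3−2N}(K̃⁺Ṽ − K̃Ṽ⁺)`, and the image of `K̃⁺Ṽ − K̃Ṽ⁺` in `𝔽_p` is the
determinant of `CollinearityOrbits.collinear_det_eq_zero` (line relation from the hypothesis via `PInt.cast_eq_zero_of_pCong`;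
`ḡ_x̄ = (−1)^{N+1}ḡ_x`; `π_j(x̄) = π_j(x)`), hence `0`; so `v_p(K̃⁺Ṽ − K̃Ṽ⁺) ≥ 1` and `v_p(Cas_j) ≥ 4 − 2N ≥ casLB + 1`
(`casLB_le_of_deep`).  `p`-adic valuations of rational numbers; nothing here bears on irrationality.
-/

noncomputable section

open Finset

namespace Summit.KontsevichZagierPeriods.Zeta5Search.ClusterValuation

open Summit.KontsevichZagierPeriods.Zeta5Search.DualSeries (InBox)
open Summit.KontsevichZagierPeriods.Zeta5Search.WedgeDictionary (coeffV dOf)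
open Summit.KontsevichZagierPeriods.Zeta5Search.CasoratianValuation (InPolytope shift casoratian)
open Summit.KontsevichZagierPeriods.Zeta5Search.BigPrime (shift_zero)
open Summit.KontsevichZagierPeriods.Zeta5Search.PadicSeries
open Summit.KontsevichZagierPeriods.Zeta5Search.LevelClass (padicNorm_vHat_le_one padicNorm_gHat_sub_le)

/-! ## §4  `CollinearityCriterionT` (regimes H0 and T at once) -/

/-- **`CollinearityCriterionT` is a theorem** (gen-2 g9, REPORT-gen2-g9 §9.1: the collinearity criterion with tame single-pole classes
allowed below the multipole minimum `−N`; the two moment congruences of the affine case are hypotheses). -/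
theorem collinearityCriterionT_holds : CollinearityCriterionT := by
  intro b p j N hb hb' hj1 hj7 hprime hp5 hpb hpd hwin hN hT hM hline hcas
  haveI : Fact p.Prime := ⟨hprime⟩
  classical
  obtain ⟨a, c, e, hac, he, hl⟩ := hline
  have hp0 : 0 < p := hprime.pos
  have hbox : InBox b := hb.1
  have h0 : 0 ≤ b 0 := hbox.1
  set n := (b 0).toNat with hn
  have hnZ : ((n : ℕ) : ℤ) = b 0 := Int.toNat_of_nonneg h0
  have hpn : p ≤ n := by omega
  obtain ⟨-, -, -, hnp2⟩ := thmA_data b hb hwin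
  have hp2 : p ≠ 2 := by omega
  have hN1 : 1 ≤ N := by omega
  have hwin' : (shift b j 0 + 2 : ℤ) < (p : ℤ) ^ 2 := by rwa [shift_zero b hj1]
  have h2j : 2 * b j ≤ b 0 := CellKit.two_mul_le_of_shift b hj1 hj7 hb'
  have hp' : (-(p : ℚ)) ≠ 0 := neg_ne_zero.2 (Nat.cast_ne_zero.2 hprime.ne_zero)
  have htwo : (2 : ZMod p) ≠ 0 := by
    intro h
    have h' : ((2 : ℕ) : ZMod p) = 0 := by exact_mod_cast h
    rw [ZMod.natCast_eq_zero_iff] at h'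
    have := Nat.le_of_dvd two_pos h'
    omega
  -- regime T for `b`: deeper classes are tame single-pole classes
  have hnu_of : ∀ x, classPoleCount b p x = 1 → tameSingle b p x = true → 0 ≤ classNu b p x := by
    intro x h1 ht
    unfold classNu; rw [if_pos ⟨h1, ht⟩]; exact le_max_right _ _
  have hTb : ∀ x, x < p → 1 ≤ classPoleCount b p x → classExp b p x < -(N : ℤ) →
      classPoleCount b p x = 1 ∧ 0 ≤ classNu b p x := by
    intro x hx _ hlt
    obtain ⟨h1, ht⟩ := hT x hx hlt
    exact ⟨h1, hnu_of x h1 ht⟩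
  -- the selected classes: all deep classes of `b`; the unhit deep classes for `b + e_j`
  set D := deepClasses b p N with hD
  have hDsub : D ⊆ range p := filter_subset _ _
  have hsel : ∀ x ∈ D, classExp b p x = -(N : ℤ) := fun x hx => (mem_filter.1 hx).2
  have hnsel : ∀ x, x < p → x ∉ D → classExp b p x = -(N : ℤ) → 1 ≤ classPoleCount b p x →
      classPoleCount b p x = 1 ∧ 0 ≤ classNu b p x :=
    fun x hx hxD hE _ => absurd (mem_filter.2 ⟨mem_range.2 hx, hE⟩) hxD
  set U := D.filter (fun x => (b j).toNat ∉ classSet b p x ∧ (b 0).toNat - (b j).toNat ∉ classSet b p x) with hU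
  have hUsub : U ⊆ range p := (filter_subset _ _).trans hDsub
  have hTb' : ∀ x, x < p → 1 ≤ classPoleCount (shift b j) p x → classExp (shift b j) p x < -(N : ℤ) →
      classPoleCount (shift b j) p x = 1 ∧ 0 ≤ classNu (shift b j) p x := by
    intro x hx hpos' hlt'
    have hlt : classExp b p x < -(N : ℤ) := lt_of_le_of_lt (classExp_shift_ge b hbox hj1 p x) hlt'
    obtain ⟨h1, ht⟩ := hT x hx hlt
    have hle := classPoleCount_shift_le b hbox hj1 p x
    exact ⟨by omega, (hnu_of x h1 ht).trans (classNu_shift_ge b hbox hj1 hpos')⟩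
  have hsel' : ∀ x ∈ U, classExp (shift b j) p x = -(N : ℤ) := by
    intro x hx
    obtain ⟨hxD, hu1, hu2⟩ := mem_filter.1 hx
    rw [classExp_shift_of_unhit b hbox hj1 hj7 h2j hu1 hu2]
    exact hsel x hxD
  have hnsel' : ∀ x, x < p → x ∉ U → classExp (shift b j) p x = -(N : ℤ) → 1 ≤ classPoleCount (shift b j) p x →
      classPoleCount (shift b j) p x = 1 ∧ 0 ≤ classNu (shift b j) p x := by
    intro x hx hxU hE' hpos'
    have hge := classExp_shift_ge b hbox hj1 p x
    rcases lt_or_eq_of_le (show classExp b p x ≤ -(N : ℤ) by omega) with hlt | heq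
    · obtain ⟨h1, ht⟩ := hT x hx hlt
      have hle := classPoleCount_shift_le b hbox hj1 p x
      exact ⟨by omega, (hnu_of x h1 ht).trans (classNu_shift_ge b hbox hj1 hpos')⟩
    · exfalso
      have hxD : x ∈ D := mem_filter.2 ⟨mem_range.2 hx, heq⟩
      by_cases hhit : (b j).toNat ∈ classSet b p x ∨ (b 0).toNat - (b j).toNat ∈ classSet b p x
      · have := classExp_shift_of_hit b hbox hj1 hj7 h2j hhit
        omega
      · push Not at hhit
        exact hxU (mem_filter.2 ⟨hxD, hhit.1, hhit.2⟩)
  -- the field data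
  set gF : ℕ → ZMod p := fun x => ((gHat b p x : ℚ) : ZMod p) with hgF
  set kF : ℕ → ZMod p := fun x => ((sigmaK b p x : ℚ) : ZMod p) with hkF
  set vF : ℕ → ZMod p := fun x => ((vHat b p x : ℚ) : ZMod p) with hvF
  set wF : ℕ → ZMod p := fun x => (((b j : ℤ) : ZMod p) - x) * (((b 0 - b j : ℤ) : ZMod p) - x) with hwF
  set s : ZMod p := (-1 : ZMod p) ^ (N + 1) with hs
  -- the four normalised sums and their images
  obtain ⟨hKden, hKcast⟩ := cast_kTilde b hb hp5 hwin hN hTb D hDsub hsel hnsel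
  obtain ⟨hVden, hVcast⟩ := cast_vTilde b hb hp5 hwin hN hTb D hDsub hsel hnsel
  obtain ⟨hK'den, hK'cast⟩ := cast_kTilde (shift b j) hb' hp5 hwin' hN hTb' U hUsub hsel' hnsel'
  obtain ⟨hV'den, hV'cast⟩ := cast_vTilde (shift b j) hb' hp5 hwin' hN hTb' U hUsub hsel' hnsel'
  rw [hU, sum_unhit_shift_eq b hb hb' hj1 hj7 hp5 hN1 (fun x => ((sigmaK b p x : ℚ) : ZMod p))
      (fun x => ((sigmaK (shift b j) p x : ℚ) : ZMod p))
      (fun x _ hE => by rw [sigmaK_shift_of_classExp_eq b hbox hj1 hE])] at hK'cast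
  rw [hU, sum_unhit_shift_eq b hb hb' hj1 hj7 hp5 hN1 (fun x => ((vHat b p x : ℚ) : ZMod p))
      (fun x => ((vHat (shift b j) p x : ℚ) : ZMod p))
      (fun x _ hE => by rw [vHat_shift_of_classExp_eq b hbox hj1 hE])] at hV'cast
  -- the determinant vanishes in `ZMod p`
  have hdet : (∑ x ∈ D, wF x * gF x * kF x) * (∑ x ∈ D, gF x * vF x) -
      (∑ x ∈ D, gF x * kF x) * (∑ x ∈ D, wF x * gF x * vF x) = 0 := by
    refine collinear_det_eq_zero D (conjClass b p) (CentreIn b p) gF kF vF wF s (a : ZMod p) (c : ZMod p) (e : ZMod p)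
      htwo ?_ ?_ ?_ ?_ ?_ ?_ ?_ ?_
    · exact fun x hx => conjClass_mem_deepClasses b hb hpn hx
    · exact fun x hx => conjClass_conjClass b (mem_range.1 (mem_filter.1 hx).1) hpn
    · exact fun x hx => centreIn_iff_conjClass_eq b hpn (mem_range.1 (mem_filter.1 hx).1)
    · exact fun x hx hcx => cast_gHat_conjClass b hb hp5 hpn hN1 hx hcx
    · intro x hx
      have hxn : x ≤ n := by have := mem_range.1 (mem_filter.1 hx).1; omega
      simp only [hwF]
      rw [cast_conjClass b hpn hxn]
      push_cast
      ring
    · by_contra hnot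
      push Not at hnot
      apply hac
      rw [← ZMod.intCast_zmod_eq_zero_iff_dvd, ← ZMod.intCast_zmod_eq_zero_iff_dvd]
      exact hnot
    · -- the line relation, class by class
      intro x hx
      have hden_k : ∀ y, ¬ p ∣ (sigmaK b p y).den :=
        fun y => PInt.of_padicNorm_le_one (padicNorm_sigmaK_le_one b h0 hnp2 hp2 y)
      have hden_v : ∀ y, ¬ p ∣ (vHat b p y).den :=
        fun y => PInt.of_padicNorm_le_one (padicNorm_vHat_le_one b h0 hnp2 hp2)
      have hden_s : ¬ p ∣ ((-1 : ℚ) ^ (N + 1)).den := PInt.pow (PInt.neg PInt.one) _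
      have hden_2 : ¬ p ∣ (2 : ℚ).den := by simpa using PInt.intCast (p := p) 2
      have hden_oK : ¬ p ∣ (orbitK b p N x).den := by
        unfold orbitK
        split_ifs
        · exact PInt.mul hden_2 (hden_k x)
        · exact PInt.add (hden_k x) (PInt.mul hden_s (hden_k _))
      have hden_oV : ¬ p ∣ (orbitV b p N x).den := by
        unfold orbitV
        split_ifs
        · exact PInt.mul hden_2 (hden_v x)
        · exact PInt.add (hden_v x) (PInt.mul hden_s (hden_v _))
      have hcast_oK : ((orbitK b p N x : ℚ) : ZMod p) =
          if CentreIn b p x then 2 * kF x else kF x + s * kF (conjClass b p x) := by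
        unfold orbitK
        split_ifs
        · rw [PInt.cast_mul hden_2 (hden_k x)]; push_cast; rfl
        · rw [PInt.cast_add (hden_k x) (PInt.mul hden_s (hden_k _)), PInt.cast_mul hden_s (hden_k _)]
          push_cast; rfl
      have hcast_oV : ((orbitV b p N x : ℚ) : ZMod p) =
          if CentreIn b p x then 2 * vF x else vF x + s * vF (conjClass b p x) := by
        unfold orbitV
        split_ifs
        · rw [PInt.cast_mul hden_2 (hden_v x)]; push_cast; rfl
        · rw [PInt.cast_add (hden_v x) (PInt.mul hden_s (hden_v _)), PInt.cast_mul hden_s (hden_v _)]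
          push_cast; rfl
      have hden_all : ¬ p ∣ ((a : ℚ) * orbitK b p N x + c * orbitV b p N x + e).den :=
        PInt.add (PInt.add (PInt.mul (PInt.intCast a) hden_oK) (PInt.mul (PInt.intCast c) hden_oV)) (PInt.intCast e)
      have h0' := PInt.cast_eq_zero_of_pCong hden_all (hl x hx)
      rw [PInt.cast_add (PInt.add (PInt.mul (PInt.intCast a) hden_oK) (PInt.mul (PInt.intCast c) hden_oV)) (PInt.intCast e),
        PInt.cast_add (PInt.mul (PInt.intCast a) hden_oK) (PInt.mul (PInt.intCast c) hden_oV),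
        PInt.cast_mul (PInt.intCast a) hden_oK, PInt.cast_mul (PInt.intCast c) hden_oV, hcast_oK, hcast_oV,
        Rat.cast_intCast, Rat.cast_intCast, Rat.cast_intCast] at h0'
      exact h0'
    · -- `e = 0`, or the two moment congruences of the hypothesis
      rcases he with he0 | ⟨hm0, hm1⟩
      · left; rw [he0, Int.cast_zero]
      · right
        constructor
        · have hden : ∀ x ∈ D, ¬ p ∣ (gHat b p x).den := fun x _ => (cast_gHat b hp5 x).1
          have h0' := PInt.cast_eq_zero_of_pCong (PInt.sum hden) hm0
          rwa [PInt.cast_sum hden] at h0'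
        · have hπ : ∀ x : ℕ, ((b j : ℚ) - x) * ((b 0 - b j : ℚ) - x) * gHat b p x =
              (((b j - x) * (b 0 - b j - x) : ℤ) : ℚ) * gHat b p x := fun x => by push_cast; ring
          have hden : ∀ x ∈ D, ¬ p ∣ (((b j : ℚ) - x) * ((b 0 - b j : ℚ) - x) * gHat b p x).den :=
            fun x _ => by rw [hπ]; exact PInt.mul (PInt.intCast _) (cast_gHat b hp5 x).1
          have h0' := PInt.cast_eq_zero_of_pCong (PInt.sum hden) hm1
          rw [PInt.cast_sum hden] at h0'
          rw [← h0']
          refine sum_congr rfl fun x _ => ?_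
          rw [hπ, PInt.cast_mul (PInt.intCast _) (cast_gHat b hp5 x).1, Rat.cast_intCast]
          simp only [hwF, hgF]
          push_cast
          ring
  -- back to `ℚ`: the normalised determinant is divisible by `p`
  set Kt := (-(p : ℚ)) ^ ((N : ℤ) - 3) * kRes b p with hKt
  set Kt' := (-(p : ℚ)) ^ ((N : ℤ) - 3) * kRes (shift b j) p with hKt'
  set Vt := (-(p : ℚ)) ^ (N : ℤ) * coeffV b with hVt
  set Vt' := (-(p : ℚ)) ^ (N : ℤ) * coeffV (shift b j) with hVt'
  have hDden : ¬ p ∣ (Kt' * Vt - Kt * Vt').den := PInt.sub (PInt.mul hK'den hVden) (PInt.mul hKden hV'den)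
  have hDcast : ((Kt' * Vt - Kt * Vt' : ℚ) : ZMod p) = 0 := by
    rw [PInt.cast_sub (PInt.mul hK'den hVden) (PInt.mul hKden hV'den), PInt.cast_mul hK'den hVden,
      PInt.cast_mul hKden hV'den, hKcast, hVcast, hK'cast, hV'cast, ← hdet]
    simp only [hgF, hkF, hvF, hwF, hD, mul_assoc]
  have hDnorm : padicNorm p (Kt' * Vt - Kt * Vt') ≤ (p : ℚ) ^ (-(1 : ℤ)) := (PInt.cast_eq_zero_iff_norm hDden).1 hDcast
  -- `Cas_j = −(−p)^{3−2N}·(K̃⁺Ṽ − K̃Ṽ⁺)` for `p ≤ d`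
  have hΩ : omegaRes b p = 0 := omegaRes_eq_zero b hb (by omega)
  have hΩ' : omegaRes (shift b j) p = 0 :=
    omegaRes_eq_zero (shift b j) hb' (by rw [BigPrime.dOf_shift b hj1 hj7]; omega)
  have hB : kRes (shift b j) p * coeffV b - kRes b p * coeffV (shift b j) =
      (-(p : ℚ)) ^ (3 - 2 * (N : ℤ)) * (Kt' * Vt - Kt * Vt') := by
    have e1 : (-(p : ℚ)) ^ (3 - 2 * (N : ℤ)) * ((-(p : ℚ)) ^ ((N : ℤ) - 3) * (-(p : ℚ)) ^ (N : ℤ)) = 1 := by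
      rw [← zpow_add₀ hp', ← zpow_add₀ hp', show (3 - 2 * (N : ℤ) + ((N : ℤ) - 3 + N)) = 0 by ring, zpow_zero]
    simp only [hKt, hKt', hVt, hVt']
    linear_combination (kRes b p * coeffV (shift b j) - kRes (shift b j) p * coeffV b) * e1
  have hcasB : casoratian b j = -((-(p : ℚ)) ^ (3 - 2 * (N : ℤ)) * (Kt' * Vt - Kt * Vt')) := by
    rw [casoratian_split b j p, hΩ, hΩ', hB]; ring
  -- the class bound at the deep multipole class, and the conclusion
  obtain ⟨x, hx, hxE⟩ := hM
  have hLB := casLB_le_of_deep b hx hxE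
  apply val_ge_of_padicNorm_le hcas
  rw [hcasB, padicNorm.neg, padicNorm.mul, LevelClass.padicNorm_neg_p_zpow]
  have hp1 : (1 : ℚ) ≤ p := one_le_p
  have hpQ : (p : ℚ) ≠ 0 := Nat.cast_ne_zero.2 hprime.ne_zero
  calc (p : ℚ) ^ (-(3 - 2 * (N : ℤ))) * padicNorm p (Kt' * Vt - Kt * Vt')
      ≤ (p : ℚ) ^ (-(3 - 2 * (N : ℤ))) * (p : ℚ) ^ (-(1 : ℤ)) := mul_le_mul_of_nonneg_left hDnorm (zpow_p_nonneg _)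
    _ = (p : ℚ) ^ (-(4 - 2 * (N : ℤ))) := by rw [← zpow_add₀ hpQ]; ring_nf
    _ ≤ (p : ℚ) ^ (-(casLB b p + 1)) := zpow_le_zpow_right₀ hp1 (by omega)

/-! ## §5  `CollinearityCriterion` (regime H0: the moments come from `GHatMoments`) -/

/-- **`CollinearityCriterion` is a theorem** (gen-2 g9, REPORT-gen2-g9 §6.2): regime H0 is the case of `CollinearityCriterionT` without
deeper classes, the two moment congruences of the affine case being supplied by the MOMENT LEMMA `gHatMoments_holds` (`deg π_j = 2`). -/
theorem collinearityCriterion_holds : CollinearityCriterion := by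
  intro b p j N hb hb' hj1 hj7 hprime hp5 hpb hpd hwin hN hEN hM hline hcas
  haveI : Fact p.Prime := ⟨hprime⟩
  classical
  obtain ⟨a, c, e, hac, he, hl⟩ := hline
  refine collinearityCriterionT_holds b p j N hb hb' hj1 hj7 hprime hp5 hpb hpd hwin hN
    (fun x hx hlt => absurd (hEN x hx) (not_le.2 hlt)) hM ⟨a, c, e, hac, ?_, hl⟩ hcas
  rcases he with he0 | hrange
  · exact Or.inl he0
  · right
    have hN1 : 1 ≤ N := by omega
    -- the three moments `Σ x^i ĝ_x ≡ 0`, `i ≤ 2`, in `ZMod p`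
    have hmom : ∀ i, i ≤ 2 →
        ∑ x ∈ deepClasses b p N, (x : ZMod p) ^ i * ((gHat b p x : ℚ) : ZMod p) = 0 := by
      intro i hi
      have hpc := gHatMoments_holds b p N i hb hprime hp5 hN1 hEN (by have hi' : (i : ℤ) ≤ 2 := (by exact_mod_cast hi); linarith)
      have hden : ∀ x ∈ deepClasses b p N, ¬ p ∣ ((x : ℚ) ^ i * gHat b p x).den :=
        fun x _ => PInt.mul (PInt.natCast_pow x i) (cast_gHat b hp5 x).1
      have h0' := PInt.cast_eq_zero_of_pCong (PInt.sum hden) hpc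
      rw [PInt.cast_sum hden] at h0'
      rw [← h0']
      refine sum_congr rfl fun x hx => ?_
      rw [PInt.cast_mul (PInt.natCast_pow x i) (cast_gHat b hp5 x).1, Rat.cast_pow, Rat.cast_natCast]
    constructor
    · have hden : ∀ x ∈ deepClasses b p N, ¬ p ∣ (gHat b p x).den := fun x _ => (cast_gHat b hp5 x).1
      refine PInt.pCong_of_cast_eq_zero (PInt.sum hden) ?_
      rw [PInt.cast_sum hden]
      simpa using hmom 0 (by norm_num)
    · have hπ : ∀ x : ℕ, ((b j : ℚ) - x) * ((b 0 - b j : ℚ) - x) * gHat b p x =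
          (((b j - x) * (b 0 - b j - x) : ℤ) : ℚ) * gHat b p x := fun x => by push_cast; ring
      have hden : ∀ x ∈ deepClasses b p N, ¬ p ∣ (((b j : ℚ) - x) * ((b 0 - b j : ℚ) - x) * gHat b p x).den :=
        fun x _ => by rw [hπ]; exact PInt.mul (PInt.intCast _) (cast_gHat b hp5 x).1
      refine PInt.pCong_of_cast_eq_zero (PInt.sum hden) ?_
      rw [PInt.cast_sum hden]
      have hexp : ∀ x : ℕ, (((((b j : ℚ) - x) * ((b 0 - b j : ℚ) - x) * gHat b p x : ℚ)) : ZMod p) =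
          (x : ZMod p) ^ 2 * ((gHat b p x : ℚ) : ZMod p)
          - (((b j : ℤ) : ZMod p) + (((b 0 : ℤ) : ZMod p) - ((b j : ℤ) : ZMod p))) *
              ((x : ZMod p) ^ 1 * ((gHat b p x : ℚ) : ZMod p))
          + ((b j : ℤ) : ZMod p) * (((b 0 : ℤ) : ZMod p) - ((b j : ℤ) : ZMod p)) *
              ((x : ZMod p) ^ 0 * ((gHat b p x : ℚ) : ZMod p)) := by
        intro x
        rw [hπ, PInt.cast_mul (PInt.intCast _) (cast_gHat b hp5 x).1, Rat.cast_intCast]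
        push_cast
        ring
      simp only [hexp, sum_add_distrib, sum_sub_distrib, ← mul_sum, hmom 0 (by norm_num), hmom 1 (by norm_num),
        hmom 2 le_rfl, mul_zero, sub_zero, add_zero]

end Summit.KontsevichZagierPeriods.Zeta5Search.ClusterValuation

end
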